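import Summits.PneNP.PneNP.Theorems.ChebyshevTracialDesignHSymmetricAmplitudeOne
import HarnessLib

/-!
# Cell pnp-psdrank, route `ChebyshevTracialDesign`: THE 𝒜₁ RUNG FROM THE ALL-DIRECTIONS CONTAINMENT BOUND, FOR ANY MASK — the mask-generic part of
# brick 146 isolated as a reduction — brick 150 (crux `TracialDecayExp20`, stmt-PneNP-19878)

Brick 150 (prover g29; MEMO-32 §9). Brick 146 assembled, for `H`-symmetric masks, (cube maximum ⇒ CG_1 per matching) ∘ (brick 101: linear ↦ containment
forms) ∘ (brick 145: all-directions containment bound) ∘ (brick 108: CG_1 ⇒ 𝒜₁). Only the third step used the symmetry of the mask. This file states the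
other three as ONE reduction valid for EVERY bounded mask `0 ≤ f ≤ G`:
* **`amplitudeOne_of_allDirections`**: for an even `n ≥ 256`, a balanced exact design of the crux's shape, and a mask `f` such that
  `Σ_M Σ_U W(U,M) f(U) (Σ_p c_M(p) x_p x_{π_Mp})² ≤ Ball·G·E` for EVERY pair-symmetric field `|c_M| ≤ 1` (the `M`-summed all-directions form of (CG_1′)),
  every degree-one factor `B_U = Σ_p x_p β_p` with `B_UB_Uᵀ ⪯ I` on the `t`-cuts and every psd contraction field `Y`:
  `Σ_{U,M} W(U,M) f(U) tr(B_UB_UᵀY_M) ≤ 8·(Ball·G·E + 60·G·n⁴·√P_{dq n−4})·r`.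
So every future all-directions bound for a mask class (small blocks per eng MEMO-26 §4, multi-block statistics via brick 148, …) yields the 𝒜₁ rung for
that class with no further work; brick 146 is the instance `Ball·E = 7·10⁶·n⁶·(e^{−a dq n} + 2^{−⌊n/40⌋})`. WHAT THIS FILE DOES NOT DO: prove any
all-directions bound; anything on `TracialDecayExp20` itself, psd rank of P_PM(K_n), or P vs NP.
[cite: GriblingDelaatLaurent2019, §5] [cite: Rothvoss2017, §2 and Lemma 7 (PDF pp. 5–8)] [cite: BrietDadushPokutta2014, Thm. 6 (§3)]
Stature: support/instrument (kernel lane, no defs, axioms standard). Supports stmt-PneNP-19878.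
-/

set_option linter.dupNamespace false -- `Summit.PneNP.PneNP.…`: summit = sub-problem (D-0017)

noncomputable section

namespace Summit.PneNP.PneNP.Theorems.ChebyshevTracialDesignAmplitudeOneOfAllDirections

open Finset Matrix Literature.Barriers.PneNP Literature.Combinatorics.Optimization
open Summit.PneNP.PneNP.Theorems.ChebyshevTracialDesignDegreeOneFrobeniusMass (value_amplitudeOne_le_of_CG1_dim)
open Summit.PneNP.PneNP.Theorems.ChebyshevTracialDesignContainmentReduction (value_sq_sub_containment_abs_le)
open Summit.PneNP.PneNP.Theorems.ChebyshevTracialDesignCrossingPlaneAverage (dq_Tq_facts)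
open Summit.PneNP.PneNP.Theorems.ChebyshevTracialDesignHSymmetricAmplitudeOne
  (exists_cube_max continuous_linearForm CG1_of_cubeMax containment_pairSymm four_le_dq)

variable {n : ℕ}

set_option maxHeartbeats 400000 in -- bricks 101 and 108 instantiated in one context
/-- **THE 𝒜₁ RUNG FROM THE ALL-DIRECTIONS CONTAINMENT BOUND (brick 150).** For an even `n ≥ 256`, a balanced exact design `(t, C, w)` of the crux's
shape, a mask `0 ≤ f ≤ G` whose `M`-summed containment values are `≤ Ball·G·E` in every pair-symmetric direction field, every degree-one factor with
`B_UB_Uᵀ ⪯ I` on the `t`-cuts and every `0 ⪯ Y_M ⪯ I`: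
`Σ_{U,M} W(U,M)·f(U)·tr(B_UB_UᵀY_M) ≤ 8·(Ball·G·E + 60·G·n⁴·√P_{dq n−4})·r`. [cite: GriblingDelaatLaurent2019, §5]
[cite: Rothvoss2017, §2 and Lemma 7 (PDF pp. 5–8)] -/
theorem amplitudeOne_of_allDirections {t : ℕ} {C : Finset ℕ} {w : ℕ → ℝ} (hev : Even n) (hn256 : 256 ≤ n)
    (hdes : IsBalancedDesign n t (Tq n) (dq n) 20 C w) (f : Finset (Fin n) → ℝ) {G : ℝ} (hG0 : 0 ≤ G) (hf0 : ∀ U, 0 ≤ f U) (hfG : ∀ U, f U ≤ G)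
    {Ball E : ℝ}
    (hall : ∀ c : PMatch n → Fin n → ℝ, (∀ M p, |c M p| ≤ 1) → (∀ M p, c M (M.2.partner p) = c M p) →
      ∑ M : PMatch n, ∑ U : OddSet n, levelWeight n t C w U M * (f U.1 *
        (∑ p : Fin n, c M p * ((if p ∈ U.1 then (1 : ℝ) else 0) * (if M.2.partner p ∈ U.1 then (1 : ℝ) else 0))) ^ 2) ≤ Ball * G * E)
    {r m : ℕ} (β : Fin n → Matrix (Fin r) (Fin m) ℝ)
    (hB : ∀ U : OddSet n, U.1.card = t →
      (1 - (∑ p, (if p ∈ U.1 then (1 : ℝ) else 0) • β p) * (∑ p, (if p ∈ U.1 then (1 : ℝ) else 0) • β p)ᵀ).PosSemidef)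
    (Y : PMatch n → Matrix (Fin r) (Fin r) ℝ) (hY : ∀ M, (Y M).PosSemidef ∧ (1 - Y M).PosSemidef) :
    ∑ U : OddSet n, ∑ M : PMatch n, levelWeight n t C w U M *
        (f U.1 *
          ((∑ p, (if p ∈ U.1 then (1 : ℝ) else 0) • β p) * (∑ p, (if p ∈ U.1 then (1 : ℝ) else 0) • β p)ᵀ * Y M).trace) ≤
      8 * (Ball * G * E + 60 * G * (n : ℝ) ^ 4 *
        Real.sqrt (∏ i ∈ range ((dq n - 4) / 2 + 1), ((2 * i + 1 : ℝ) / ((n : ℝ) - 2 * i)))) * r := by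
  classical
  obtain ⟨-, -, hdqT, -⟩ := dq_Tq_facts (show 16 ≤ n by omega)
  have hD4 : 4 ≤ dq n := four_le_dq hn256
  have hex : IsExactDesign n t (Tq n) (dq n) 20 C w := hdes.1
  have hbal : n ≤ 4 * t := hdes.2
  obtain ⟨c', hc'⟩ := hex.1
  subst hc'
  have htn : 2 * (2 * c' + 1) + 2 ≤ n := hex.2.1
  have hTt : Tq n ≤ 2 * c' + 1 := hex.2.2.1
  have ht0 : 0 < 2 * c' + 1 := by omega
  have htn' : 2 * c' + 1 < n := by omega
  have hDc : dq n ≤ 2 * c' := by omega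
  have hvar : ∑ c ∈ C, |w c| ≤ 20 := hex.2.2.2.2.2.2
  -- a `t`-cut exists
  obtain ⟨c₀, hc₀⟩ := nonempty_of_exact hex.exact
  obtain ⟨q₀, hq₀⟩ := (hex.2.2.2.1 c₀ hc₀).2.2.2
  have hT : 0 < (univ.filter fun U : OddSet n => U.1.card = 2 * c' + 1).card :=
    card_pos.2 ⟨q₀.1, mem_filter.2 ⟨mem_univ _, (mem_Qset_iff.1 hq₀).1⟩⟩
  -- the error scale
  have hP0 : 0 ≤ Real.sqrt (∏ i ∈ range ((dq n - 4) / 2 + 1), ((2 * i + 1 : ℝ) / ((n : ℝ) - 2 * i))) := Real.sqrt_nonneg _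
  have hn1 : (1 : ℝ) ≤ n := by exact_mod_cast (show 1 ≤ n by omega)
  -- the degenerate case `G = 0`
  have hBall : 0 ≤ Ball * G * E := by
    have h0 := hall 0 (fun M p => by simp) (fun M p => rfl)
    have : ∑ M : PMatch n, ∑ U : OddSet n, levelWeight n (2 * c' + 1) C w U M * (f U.1 *
        (∑ p : Fin n, (0 : PMatch n → Fin n → ℝ) M p * ((if p ∈ U.1 then (1 : ℝ) else 0) * (if M.2.partner p ∈ U.1 then (1 : ℝ) else 0))) ^ 2) = 0 := by
      simp
    linarith
  rcases eq_or_lt_of_le hG0 with hG | hG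
  · have hψ : ∀ U, f U = 0 := fun U => le_antisymm (by rw [hG]; exact hfG U) (hf0 U)
    have hl : ∑ U : OddSet n, ∑ M : PMatch n, levelWeight n (2 * c' + 1) C w U M *
        (f U.1 * ((∑ p, (if p ∈ U.1 then (1 : ℝ) else 0) • β p) * (∑ p, (if p ∈ U.1 then (1 : ℝ) else 0) • β p)ᵀ * Y M).trace) = 0 := by
      simp [hψ]
    rw [hl]
    have hr0 : (0 : ℝ) ≤ r := Nat.cast_nonneg _
    have : 0 ≤ 60 * G * (n : ℝ) ^ 4 * Real.sqrt (∏ i ∈ range ((dq n - 4) / 2 + 1), ((2 * i + 1 : ℝ) / ((n : ℝ) - 2 * i))) := by positivity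
    positivity
  -- §1: the per-matching cube maximisers and CG_1
  have hmaxex : ∀ M : PMatch n, ∃ g₀ : Fin n → ℝ, (∀ p, |g₀ p| ≤ 1) ∧ ∀ g : Fin n → ℝ, (∀ p, |g p| ≤ 1) →
      ∑ U : OddSet n, levelWeight n (2 * c' + 1) C w U M * (f U.1 *
          (∑ p, g p * (if p ∈ U.1 then (1 : ℝ) else 0)) ^ 2) ≤
        ∑ U : OddSet n, levelWeight n (2 * c' + 1) C w U M * (f U.1 *
          (∑ p, g₀ p * (if p ∈ U.1 then (1 : ℝ) else 0)) ^ 2) :=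
    fun M => exists_cube_max _ (continuous_linearForm (levelWeight n (2 * c' + 1) C w) M (fun U => f U.1))
  choose g₀ hg₀1 hg₀max using hmaxex
  have hε0 : ∀ M : PMatch n, 0 ≤ ∑ U : OddSet n, levelWeight n (2 * c' + 1) C w U M * (f U.1 *
      (∑ p, g₀ M p * (if p ∈ U.1 then (1 : ℝ) else 0)) ^ 2) := fun M => by
    have h := hg₀max M 0 (fun p => by simp)
    simpa using h
  have hCG : ∀ (M : PMatch n) (g : Fin n → ℝ),
      ∑ U : OddSet n, levelWeight n (2 * c' + 1) C w U M * (f U.1 *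
          (∑ p, g p * (if p ∈ U.1 then (1 : ℝ) else 0)) ^ 2) ≤
        (∑ U : OddSet n, levelWeight n (2 * c' + 1) C w U M * (f U.1 *
          (∑ p, g₀ M p * (if p ∈ U.1 then (1 : ℝ) else 0)) ^ 2)) * ∑ p, g p ^ 2 :=
    fun M g => CG1_of_cubeMax _ M _ (g₀ M) (hg₀max M) g
  -- brick 108: the value on the amplitude class
  have h108 := value_amplitudeOne_le_of_CG1_dim ht0 htn' hT (levelWeight n (2 * c' + 1) C w)
    (fun U => f U.1) β hB Y hY _ hCG
  have hεsum : ∑ M : PMatch n, max (∑ U : OddSet n, levelWeight n (2 * c' + 1) C w U M * (f U.1 *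
      (∑ p, g₀ M p * (if p ∈ U.1 then (1 : ℝ) else 0)) ^ 2)) 0 =
      ∑ M : PMatch n, ∑ U : OddSet n, levelWeight n (2 * c' + 1) C w U M * (f U.1 *
      (∑ p, g₀ M p * (if p ∈ U.1 then (1 : ℝ) else 0)) ^ 2) :=
    sum_congr rfl fun M _ => max_eq_left (hε0 M)
  rw [hεsum] at h108
  -- brick 101: linear forms ↦ containment forms (mask `ψ/G ∈ [0,1]`)
  have hf1 : ∀ U : OddSet n, |f U.1 / G| ≤ 1 := fun U => by
    rw [abs_div, abs_of_pos hG, div_le_one hG, abs_of_nonneg (hf0 _)]; exact hfG _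
  have h101 := value_sq_sub_containment_abs_le hev hex hDc hD4 (fun U => f U.1 / G) hf1 g₀ hg₀1
  have hscale : ∀ (F : PMatch n → OddSet n → ℝ),
      ∑ M : PMatch n, ∑ U : OddSet n, levelWeight n (2 * c' + 1) C w U M * (f U.1 / G * F M U) =
      (∑ M : PMatch n, ∑ U : OddSet n, levelWeight n (2 * c' + 1) C w U M * (f U.1 * F M U)) / G := by
    intro F
    rw [sum_div]; refine sum_congr rfl fun M _ => ?_
    rw [sum_div]; refine sum_congr rfl fun U _ => ?_
    field_simp
  rw [hscale, hscale, ← sub_div, abs_div, abs_of_pos hG, div_le_iff₀ hG] at h101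
  have hlin := (abs_sub_le_iff.1 h101).1
  -- the all-directions hypothesis on the pair-symmetrised maximising field
  have h145' := hall (fun M p => (g₀ M p + g₀ M (M.2.partner p)) / 2)
    (fun M p => by
      have h1 := abs_le.1 (hg₀1 M p); have h2 := abs_le.1 (hg₀1 M (M.2.partner p))
      rw [abs_le]; constructor <;> linarith)
    (fun M p => by simp only [M.2.partner_partner]; ring)
  have hsymm : ∑ M : PMatch n, ∑ U : OddSet n, levelWeight n (2 * c' + 1) C w U M * (f U.1 *
      (∑ p, g₀ M p * ((if p ∈ U.1 then (1 : ℝ) else 0) * (if M.2.partner p ∈ U.1 then (1 : ℝ) else 0))) ^ 2) =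
      ∑ M : PMatch n, ∑ U : OddSet n, levelWeight n (2 * c' + 1) C w U M * (f U.1 *
      (∑ p, (g₀ M p + g₀ M (M.2.partner p)) / 2 *
        ((if p ∈ U.1 then (1 : ℝ) else 0) * (if M.2.partner p ∈ U.1 then (1 : ℝ) else 0))) ^ 2) :=
    sum_congr rfl fun M _ => Fintype.sum_congr _ _ fun U => by rw [containment_pairSymm M U.1 (g₀ M)]
  rw [hsymm] at hlin
  -- the balance ratio `n(n−1)/(t(n−t)) ≤ 8`
  have htr : (n : ℝ) ≤ 4 * ((2 * c' + 1 : ℕ) : ℝ) := by exact_mod_cast hbal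
  have htn'' : 2 * ((2 * c' + 1 : ℕ) : ℝ) + 2 ≤ n := by exact_mod_cast htn
  have htpos : (0 : ℝ) < ((2 * c' + 1 : ℕ) : ℝ) * ((n : ℝ) - (2 * c' + 1 : ℕ)) := by
    apply mul_pos <;> [exact_mod_cast ht0; linarith]
  have hratio : (n : ℝ) * ((n : ℝ) - 1) / (((2 * c' + 1 : ℕ) : ℝ) * ((n : ℝ) - (2 * c' + 1 : ℕ))) ≤ 8 := by
    rw [div_le_iff₀ htpos]; nlinarith
  -- assemble
  have hP := mul_nonneg (mul_nonneg (by norm_num : (0 : ℝ) ≤ 3) (pow_nonneg (Nat.cast_nonneg n) 4)) (mul_nonneg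
    (sum_nonneg fun c (_ : c ∈ C) => abs_nonneg (w c)) hP0)
  have hL : ∑ M : PMatch n, ∑ U : OddSet n, levelWeight n (2 * c' + 1) C w U M * (f U.1 *
      (∑ p, g₀ M p * (if p ∈ U.1 then (1 : ℝ) else 0)) ^ 2) ≤
      Ball * G * E +
        3 * (n : ℝ) ^ 4 * (20 * Real.sqrt (∏ i ∈ range ((dq n - 4) / 2 + 1), ((2 * i + 1 : ℝ) / ((n : ℝ) - 2 * i)))) * G := by
    have hw : 3 * (n : ℝ) ^ 4 * ((∑ c ∈ C, |w c|) * Real.sqrt (∏ i ∈ range ((dq n - 4) / 2 + 1),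
        ((2 * i + 1 : ℝ) / ((n : ℝ) - 2 * i)))) * G ≤
        3 * (n : ℝ) ^ 4 * (20 * Real.sqrt (∏ i ∈ range ((dq n - 4) / 2 + 1), ((2 * i + 1 : ℝ) / ((n : ℝ) - 2 * i)))) * G := by
      refine mul_le_mul_of_nonneg_right (mul_le_mul_of_nonneg_left (mul_le_mul_of_nonneg_right hvar hP0) (by positivity)) hG.le
    linarith
  have hLnn : 0 ≤ ∑ M : PMatch n, ∑ U : OddSet n, levelWeight n (2 * c' + 1) C w U M * (f U.1 *
      (∑ p, g₀ M p * (if p ∈ U.1 then (1 : ℝ) else 0)) ^ 2) := sum_nonneg fun M _ => hε0 M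
  refine h108.trans ?_
  have hr0 : (0 : ℝ) ≤ r := Nat.cast_nonneg _
  calc (∑ M : PMatch n, ∑ U : OddSet n, levelWeight n (2 * c' + 1) C w U M * (f U.1 *
        (∑ p, g₀ M p * (if p ∈ U.1 then (1 : ℝ) else 0)) ^ 2)) *
        ((r : ℝ) * ((n : ℝ) * ((n : ℝ) - 1)) / (((2 * c' + 1 : ℕ) : ℝ) * ((n : ℝ) - (2 * c' + 1 : ℕ))))
      = (∑ M : PMatch n, ∑ U : OddSet n, levelWeight n (2 * c' + 1) C w U M * (f U.1 *
        (∑ p, g₀ M p * (if p ∈ U.1 then (1 : ℝ) else 0)) ^ 2)) * (r : ℝ) *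
        ((n : ℝ) * ((n : ℝ) - 1) / (((2 * c' + 1 : ℕ) : ℝ) * ((n : ℝ) - (2 * c' + 1 : ℕ)))) := by ring
    _ ≤ (Ball * G * E +
        3 * (n : ℝ) ^ 4 * (20 * Real.sqrt (∏ i ∈ range ((dq n - 4) / 2 + 1), ((2 * i + 1 : ℝ) / ((n : ℝ) - 2 * i)))) * G) *
        (r : ℝ) * 8 := by
          refine mul_le_mul (mul_le_mul_of_nonneg_right hL hr0) hratio (by positivity) ?_
          have : 0 ≤ 3 * (n : ℝ) ^ 4 * (20 * Real.sqrt (∏ i ∈ range ((dq n - 4) / 2 + 1), ((2 * i + 1 : ℝ) / ((n : ℝ) - 2 * i)))) * G := by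
            positivity
          positivity
    _ = 8 * (Ball * G * E + 60 * G * (n : ℝ) ^ 4 *
        Real.sqrt (∏ i ∈ range ((dq n - 4) / 2 + 1), ((2 * i + 1 : ℝ) / ((n : ℝ) - 2 * i)))) * r := by ring

end Summit.PneNP.PneNP.Theorems.ChebyshevTracialDesignAmplitudeOneOfAllDirections

end
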